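import Mathlib.Analysis.Calculus.FDeriv.Basic
import Mathlib.Analysis.Calculus.ContDiff.Defs
import Mathlib.Analysis.SpecialFunctions.Sqrt
import Mathlib.LinearAlgebra.Matrix.Determinant.Basic
import Mathlib.LinearAlgebra.Matrix.NonsingularInverse
import Mathlib.LinearAlgebra.Matrix.PosDef
import Mathlib.LinearAlgebra.Matrix.SchurComplement
import Mathlib.GroupTheory.Perm.Fin
import Mathlib.Analysis.Calculus.Deriv.Inv
import Mathlib.Analysis.Calculus.FDeriv.Mul
import Mathlib.Analysis.Calculus.FDeriv.Add
import Mathlib.Analysis.Calculus.FDeriv.Prod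
import Mathlib.GroupTheory.Perm.Sign
import Mathlib.Data.Nat.Factorial.DoubleFactorial
import Literature.NumberTheory.Transcendental.SemialgebraicMaps
import HarnessLib

/-!
# The Euler (Pfaffian) density and Chern's transgression form of a metric in coordinates

Topic `Literature/Geometry/Riemannian`. Definition request `defn-chernTransgression` (route
`KontsevichZagierPeriods/GaussBonnetChain`, schema item `EqualRankTransgression`): the coordinate
Chern–Gauss–Bonnet package for a Riemannian metric given as a matrix-valued function
`g : (Fin d → ℝ) → Matrix (Fin d) (Fin d) ℝ` on (an open subset of) `ℝᵈ = Fin d → ℝ`, `d = 2p` even,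
and a vector field `V : (Fin d → ℝ) → (Fin d → ℝ)`. Everything is an EXPLICIT expression in
`g, ∂g, ∂²g, V, ∂V` (rational, up to the square roots `√det g` and `|V|_g`), which is the form in which
the Kontsevich–Zagier calculus consumes it; no manifolds are used.

* `coordPartial k f x = ∂ₖf(x) := Df(x)(eₖ)`; `coordChristoffel g x i j k = Γⁱⱼₖ(x)`;
  `coordRiemannUp g x i j k l = Rⁱⱼₖₗ`, `coordRiemann g x i j k l = Rᵢⱼₖₗ = gᵢₘ Rᵐⱼₖₗ` (conventions below);
  `metricNormSq g x v = |v|²_g`, `unitField g V x = V(x)/|V(x)|_g =: u(x)`,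
  `covDerivUnitField g V x i k = (∇ₖu)ᵢ = gᵢⱼ(∂ₖuʲ + Γʲₖₗ uˡ)`.
* `eulerDensity g x = E(x)`, the density of the (un-normalised) Pfaffian of the curvature:
  `Pf(Ω) = E dx¹ ∧ ⋯ ∧ dxᵈ` where, for a positively oriented `g`-orthonormal coframe `θ` with curvature
  forms `Ωᵢⱼ = ½ Rᵢⱼₖₗ θᵏ ∧ θˡ`, `Pf(Ω) := (2ᵖ p!)⁻¹ ∑_σ sgn σ · Ω_{σ₁σ₂} ∧ ⋯ ∧ Ω_{σ_{d-1}σ_d}`. In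
  coordinates (this is the definition):
  `E = (4ᵖ p! √det g)⁻¹ ∑_{σ,τ ∈ S_d} sgn σ sgn τ ∏_{m<p} R_{σ(2m) σ(2m+1) τ(2m) τ(2m+1)}`.
  For constant sectional curvature `K` it equals `Kᵖ (d-1)!! √det g` (no powers of `π`); in Chern's
  normalisation `E dx = (2π)ᵖ · Ω`, `Ω` the Gauss–Bonnet integrand of Chern 1945, (10), `∫_M Ω = χ(M)`.
* `chernTransgression g V i x = Πᵢ(x)`, the `d` components of the `(d-1)`-form
  `V̂*Π = ∑ᵢ Πᵢ · ι_{∂ᵢ}(dx¹ ∧ ⋯ ∧ dxᵈ)` (so that `d(V̂*Π) = (∑ᵢ ∂ᵢΠᵢ) dx¹ ∧ ⋯ ∧ dxᵈ`), where `Π` is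
  Chern's transgression form on the unit sphere bundle pulled back by the unit field `V̂ = u`,
  normalised so that `dΠ = Pf(Ω)` (i.e. `Π = -(2π)ᵖ · Π^{Chern 1945, (9)}`):
  `Π = ∑_{k<p} Φₖ / ((d-2k-1)!! 2ᵏ k!)`, `Φₖ = ∑_{α ∈ S_{d-1}} sgn α · Ω_{α₁α₂} ∧ ⋯ ∧ Ω_{α_{2k-1}α_{2k}} ∧
  ω_{α_{2k+1} d} ∧ ⋯ ∧ ω_{α_{d-1} d}` in a positively oriented orthonormal frame with `e_d = u`
  (`ω_{ba} = ⟨∇e_a, e_b⟩`, so `ω_{αd} = ⟨∇u, e_α⟩`; Chern 1945, (4), (9) up to the dictionary in the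
  design notes). In coordinates (this is the definition):
  `Πᵢ = -(√det g)⁻¹ ∑_{k<p} ((d-2k-1)!! 4ᵏ k!)⁻¹ ∑_{σ,τ ∈ S_d, τ(0)=i} sgn σ sgn τ ·
        u_{σ(0)} · ∏_{m<k} R_{σ(2m+1)σ(2m+2)τ(2m+1)τ(2m+2)} · ∏_{2k+1 ≤ s < d} (∇_{τ(s)} u)_{σ(s)}`,
  with `uᵢ = gᵢⱼuʲ`.
* PROVED: `chernTransgression_flat_radial` (flat metric, `V(x) = x`: `Πᵢ(x) = -2ᵖ⁻¹(p-1)! xᵢ/|x|ᵈ`,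
  the coordinate form of "`Π` restricted to a fibre is `(d-2)!!` times the volume form of the fibre
  sphere", Chern 1944, (26), Chern 1945, (14)–(16): its flux through every sphere around `0` is
  `-2ᵖ⁻¹(p-1)!·vol(S^{d-1}) = -(2π)ᵖ = -(d-1)!!·vol(Sᵈ)/2`, i.e. `2π, 4π², 8π³` in absolute value for
  `d = 2, 4, 6`, positive with the boundary orientation of the complement of a small ball) — this
  pins the normalisation and the sign of `Π`; and the flat-case lemmas `coordChristoffel_flat`,
  `coordRiemann_flat`, `covDerivUnitField_flat`, `det_flatRadialMatrix`.
* Named facts (not proved here): `div_chernTransgression_eq_eulerDensity` (`∑ᵢ ∂ᵢΠᵢ = E` where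
  `V ≠ 0`; Chern 1944, (23) / Chern 1945, (11): `dΠ = Ω` on the sphere bundle) and
  `isSemialgebraicFunOn_eulerDensity_chernTransgression` (`ℚ`-semialgebraic data give
  `ℚ`-semialgebraic `E`, `Πᵢ`; Bochnak–Coste–Roy 1998, §2.2 and §2.9).

## Conventions (fixed here; Lee 2018, (5.10), Prop. 7.4, (7.7), Prop. 8.36)

`Γⁱⱼₖ = ½ gⁱˡ(∂ⱼg_{lk} + ∂ₖg_{jl} - ∂ₗg_{jk})`, `∇_{∂ⱼ}∂ₖ = Γⁱⱼₖ ∂ᵢ` (Lee 2018, (5.10));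
`R(X,Y)Z = ∇_X∇_Y Z - ∇_Y∇_X Z - ∇_{[X,Y]}Z` and `R(∂ₖ,∂ₗ)∂ⱼ = Rⁱⱼₖₗ ∂ᵢ` (so `Rⁱⱼₖₗ` is Lee's
`R_{klj}{}^i`, Prop. 7.4), i.e. `Rⁱⱼₖₗ = ∂ₖΓⁱₗⱼ - ∂ₗΓⁱₖⱼ + ΓⁱₖₘΓᵐₗⱼ - ΓⁱₗₘΓᵐₖⱼ`, and
`Rᵢⱼₖₗ = gᵢₘRᵐⱼₖₗ = ⟨R(∂ₖ,∂ₗ)∂ⱼ, ∂ᵢ⟩ = Rm(∂ₖ,∂ₗ,∂ⱼ,∂ᵢ)` (Lee 2018, (7.7); Lee's `R_{klji}`): skew in `ij`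
and in `kl`, the sectional curvature of the plane `∂ᵢ ∧ ∂ⱼ` is `Rᵢⱼᵢⱼ/(gᵢᵢgⱼⱼ - gᵢⱼ²)`, and constant
curvature `K` means `Rᵢⱼₖₗ = K(gᵢₖgⱼₗ - gᵢₗgⱼₖ)` (Lee 2018, Prop. 8.36). Partial derivatives are Fréchet
derivatives on coordinate vectors, `∂ₖf(x) = fderiv ℝ f x (Pi.single k 1)` (junk `0` where `f` is
not differentiable).

## Design notes

* Dictionary with Chern's papers: Chern writes `deᵢ = ωᵢⱼeⱼ`, `Ωᵢⱼ = dωᵢⱼ - ωᵢₖωₖⱼ` (1945, (2)), so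
  `ω^{Ch}ᵢⱼ = ω_{ji}` and `Ω^{Ch}ᵢⱼ = -Ωᵢⱼ` in the conventions above (for the unit sphere
  `Ω^{Ch}₁₂ = -θ¹∧θ²`); hence `Φₖ^{Ch} = (-1)ᵏ⁺¹Φₖ`, `Π^{Ch} = -(2π)⁻ᵖ Π`, and Chern 1945, (10)–(11)
  (`Ω = (-1)ᵖ(2²ᵖπᵖp!)⁻¹ ∑ ε Ω^{Ch}⋯Ω^{Ch}`, `-dΠ^{Ch} = Ω`) read `d(V̂*Π) = E dx¹∧⋯∧dxᵈ` here. The sign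
  of the 1944 paper's `Ω` ((7) there) is corrected in Chern 1945 (footnote to (9)); we follow 1945.
  The recursion behind (9)/(11) in the present conventions is `dΦₖ = -2kΨₖ₋₁ + (d-1-2k)Ψₖ`,
  `Ψₖ = ∑_α sgn α Ω_{α₁α₂}⋯Ω_{α_{2k-1}α_{2k}} Ω_{α_{2k+1}d} ω_{α_{2k+2}d}⋯ω_{α_{d-1}d}`, `Pf(Ω) = Ψₚ₋₁/(2ᵖ⁻¹(p-1)!)`.
* Passage frame → coordinates: a full `ε`-contraction of a covariant `d`-tensor in an orthonormal
  frame equals `(√det g)⁻¹` times the same contraction of its coordinate components; the `2k` form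
  slots of the curvature factors and the `d-1-2k` form slots of the `ω_{αd} = (∇u)_α` factors are
  then contracted with the second permutation `τ`, whose value `τ(0) = i` records which `dxⁱ` is
  missing; moving the `u`-slot to the front costs the sign `(-1)^{d-1} = -1`.
* Only EVEN `d` is meaningful. The pairings use `p = d/2`; for odd `d` both `eulerDensity` and
  `chernTransgression` are unspecified junk (the formulas leave the last slot unpaired) and every
  statement below carries `Even d`. Other junk values: `E = 0`-ish garbage where `det g(x) ≤ 0`
  (`√` and `⁻¹` junk), `u = 0` where `V = 0` or `|V|_g = 0`; all statements exclude these points.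
* Smoothness: `Πᵢ` contains `∂²g` and `∂V`, so the pointwise divergence identity is stated for `g` of
  class `C³` and `V` of class `C²` (then `Πᵢ ∈ C¹`); Chern assumes `gᵢⱼ ∈ C³` (1944, §1).
* Mathlib has no Riemann curvature tensor of a metric in coordinates (searched: `christoffel`,
  `Riemann`, `curvature`, `Pfaffian`); the tree's chart calculus (`Lorentzian/ChartCalculus.lean`,
  `Riemannian/RicciDeTurckCoord.lean`) works with `E → (E →L E →L ℝ)` on `Opens E` and Mathlib
  connections, not with the elementary matrix functions required by the Kontsevich–Zagier routes, so
  the present file is self-contained and elementary on purpose. No Pfaffian of a matrix is defined: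
  the double-`ε` expansion above is used directly.
* NOT here: the divergence theorem, the naturality of `Πᵢ` under isometries (vector-density law),
  one-parameter (homotopy) versions, odd dimensions (Chern 1945 treats them), and any integral over
  spheres (the flat radial closed form is the pointwise statement from which fibre integrals follow).

## References

* S.-S. Chern, *A simple intrinsic proof of the Gauss–Bonnet formula for closed Riemannian
  manifolds*, Ann. of Math. 45 (1944) 747–752: (3) structure equations, (7) `Ω`, (15)–(17) `Φₖ, Ψₖ`,
  recursion, (23)–(24) `Ω = dΠ`, (26) `Φ₀` on a fibre. [`Chern1944`]
* S.-S. Chern, *On the curvatura integra in a Riemannian manifold*, Ann. of Math. 46 (1945) 674–684: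
  (2), (4), (6), (9), (10), (11) `-dΠ = Ω`, (14)–(16) index `= lim ∫_S Π`. [`Chern1945`]
* C. B. Allendoerfer, A. Weil, *The Gauss–Bonnet theorem for Riemannian polyhedra*, Trans. AMS 53
  (1943) 101–129. [`AllendoerferWeil1943`]
* J. M. Lee, *Introduction to Riemannian Manifolds*, 2nd ed., GTM 176 (2018): (5.10) (Christoffel
  symbols), Prop. 7.4 / (7.4) (components of the curvature endomorphism), (7.7)–(7.8) (`Rm`),
  Prop. 8.36 (constant curvature). [`Lee2018`]
* J. Bochnak, M. Coste, M.-F. Roy, *Real Algebraic Geometry* (1998), §2.2 (Prop. 2.2.6), §2.9.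
  [`BochnakCosteRoy1998`]
-/

noncomputable section

open Matrix Finset
open scoped Nat

namespace Literature.Geometry.Riemannian

variable {d : ℕ}

/-! ### Coordinate calculus of a matrix-valued metric -/

/-- The `k`-th partial derivative `∂ₖf(x) = Df(x)(eₖ)` of a scalar function on `ℝᵈ = Fin d → ℝ`
(Fréchet derivative on the coordinate vector `Pi.single k 1`; `0` where `f` is not differentiable).
[folklore] -/
def coordPartial (k : Fin d) (f : (Fin d → ℝ) → ℝ) (x : Fin d → ℝ) : ℝ :=
  fderiv ℝ f x (Pi.single k 1)

/-- Unfolding of `coordPartial`. [folklore] -/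
theorem coordPartial_def (k : Fin d) (f : (Fin d → ℝ) → ℝ) (x : Fin d → ℝ) :
    coordPartial k f x = fderiv ℝ f x (Pi.single k 1) := rfl

/-- The partial derivatives of a constant function vanish. [folklore] -/
@[simp]
theorem coordPartial_const (k : Fin d) (c : ℝ) (x : Fin d → ℝ) :
    coordPartial k (fun _ => c) x = 0 := by
  simp [coordPartial]

/-- The **Christoffel symbols** `Γⁱⱼₖ(x) = ½ ∑ₗ gⁱˡ(x) (∂ⱼg_{lk} + ∂ₖg_{jl} - ∂ₗg_{jk})(x)` of the
Levi-Civita connection of the coordinate metric `g` (`∇_{∂ⱼ}∂ₖ = Γⁱⱼₖ∂ᵢ`; `gⁱˡ` the inverse matrix;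
symmetric in `j, k` when `g` is symmetric). [cite: Lee2018, (5.10)] -/
def coordChristoffel (g : (Fin d → ℝ) → Matrix (Fin d) (Fin d) ℝ) (x : Fin d → ℝ) (i j k : Fin d) : ℝ :=
  2⁻¹ * ∑ l, (g x)⁻¹ i l *
    (coordPartial j (fun y => g y l k) x + coordPartial k (fun y => g y j l) x -
      coordPartial l (fun y => g y j k) x)

/-- The **Riemann curvature tensor** `Rⁱⱼₖₗ = ∂ₖΓⁱₗⱼ - ∂ₗΓⁱₖⱼ + ∑ₘ(ΓⁱₖₘΓᵐₗⱼ - ΓⁱₗₘΓᵐₖⱼ)` of the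
coordinate metric `g`, i.e. `R(∂ₖ,∂ₗ)∂ⱼ = Rⁱⱼₖₗ∂ᵢ` with `R(X,Y) = ∇_X∇_Y - ∇_Y∇_X - ∇_{[X,Y]}` (this is
`R_{klj}{}^i` in the index order of Lee 2018, Prop. 7.4, formula (7.4)). [cite: Lee2018, Prop. 7.4] -/
def coordRiemannUp (g : (Fin d → ℝ) → Matrix (Fin d) (Fin d) ℝ) (x : Fin d → ℝ) (i j k l : Fin d) : ℝ :=
  coordPartial k (fun y => coordChristoffel g y i l j) x -
      coordPartial l (fun y => coordChristoffel g y i k j) x +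
    ∑ m, (coordChristoffel g x i k m * coordChristoffel g x m l j -
      coordChristoffel g x i l m * coordChristoffel g x m k j)

/-- The fully covariant **Riemann tensor** `Rᵢⱼₖₗ = ∑ₘ gᵢₘRᵐⱼₖₗ = ⟨R(∂ₖ,∂ₗ)∂ⱼ, ∂ᵢ⟩ = Rm(∂ₖ,∂ₗ,∂ⱼ,∂ᵢ)`
of the coordinate metric `g` (Lee 2018, (7.7); Lee's `R_{klji}`): skew in `ij` and in `kl`, and
constant sectional curvature `K` means `Rᵢⱼₖₗ = K(gᵢₖgⱼₗ - gᵢₗgⱼₖ)` (Lee 2018, Prop. 8.36).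
[cite: Lee2018, (7.7) and Prop. 8.36] -/
def coordRiemann (g : (Fin d → ℝ) → Matrix (Fin d) (Fin d) ℝ) (x : Fin d → ℝ) (i j k l : Fin d) : ℝ :=
  ∑ m, g x i m * coordRiemannUp g x m j k l

/-- The squared length `|v|²_g = vᵀ g(x) v` of a coordinate vector at `x`. [folklore] -/
def metricNormSq (g : (Fin d → ℝ) → Matrix (Fin d) (Fin d) ℝ) (x : Fin d → ℝ) (v : Fin d → ℝ) : ℝ :=
  v ⬝ᵥ (g x *ᵥ v)

/-- The **unit field** `u = V̂ = V/|V|_g` of a vector field `V` (junk `0` where `V = 0`). [folklore] -/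
def unitField (g : (Fin d → ℝ) → Matrix (Fin d) (Fin d) ℝ) (V : (Fin d → ℝ) → (Fin d → ℝ))
    (x : Fin d → ℝ) : Fin d → ℝ :=
  (Real.sqrt (metricNormSq g x (V x)))⁻¹ • V x

/-- The lowered **covariant derivative of the unit field**,
`(∇ₖu)ᵢ = ∑ⱼ gᵢⱼ (∂ₖuʲ + ∑ₗ Γʲₖₗ uˡ)` with `u = unitField g V` (first index: vector slot, lowered;
second index: direction of differentiation). In an orthonormal frame `e₁, …, e_d = u` these are the
components of Chern's forms `ω_{αd}`/`θ_α = du_α + u_βω_{βα}`. [cite: Chern1944, (11)] -/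
def covDerivUnitField (g : (Fin d → ℝ) → Matrix (Fin d) (Fin d) ℝ) (V : (Fin d → ℝ) → (Fin d → ℝ))
    (x : Fin d → ℝ) (i k : Fin d) : ℝ :=
  ∑ j, g x i j *
    (coordPartial k (fun y => unitField g V y j) x + ∑ l, coordChristoffel g x j k l * unitField g V x l)

/-! ### The Euler density -/

/-- The even slot `2m` of the `m`-th pair `(2m, 2m+1)` of `Fin d`, `m < d/2`. [folklore] -/
def pairFst (m : Fin (d / 2)) : Fin d := ⟨2 * (m : ℕ), by have := m.2; omega⟩

/-- The odd slot `2m+1` of the `m`-th pair `(2m, 2m+1)` of `Fin d`, `m < d/2`. [folklore] -/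
def pairSnd (m : Fin (d / 2)) : Fin d := ⟨2 * (m : ℕ) + 1, by have := m.2; omega⟩

/-- `pairFst m = 2m` as a natural number. [folklore] -/
@[simp] theorem pairFst_val (m : Fin (d / 2)) : (pairFst m : ℕ) = 2 * m := rfl

/-- `pairSnd m = 2m + 1` as a natural number. [folklore] -/
@[simp] theorem pairSnd_val (m : Fin (d / 2)) : (pairSnd m : ℕ) = 2 * m + 1 := rfl

/-- The double alternating curvature sum
`B(x) = ∑_{σ,τ ∈ S_d} sgn σ sgn τ ∏_{m < d/2} R_{σ(2m)σ(2m+1)τ(2m)τ(2m+1)}(x)`, i.e. `4ᵖ p!` times the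
Pfaffian polynomial evaluated on the coordinate curvature components (`d = 2p`).
[cite: Chern1945, (10)] -/
def eulerDensitySum (g : (Fin d → ℝ) → Matrix (Fin d) (Fin d) ℝ) (x : Fin d → ℝ) : ℝ :=
  ∑ σ : Equiv.Perm (Fin d), ∑ τ : Equiv.Perm (Fin d),
    ((Equiv.Perm.sign σ : ℤ) : ℝ) * ((Equiv.Perm.sign τ : ℤ) : ℝ) *
      ∏ m : Fin (d / 2), coordRiemann g x (σ (pairFst m)) (σ (pairSnd m)) (τ (pairFst m)) (τ (pairSnd m))

/-- The **Euler (Pfaffian) density** of the coordinate metric `g` in even dimension `d = 2p`: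
`E(x) = (4ᵖ p! √det g(x))⁻¹ ∑_{σ,τ ∈ S_d} sgn σ sgn τ ∏_{m<p} R_{σ(2m)σ(2m+1)τ(2m)τ(2m+1)}(x)`, the
function with `Pf(Ω) = E dx¹∧⋯∧dxᵈ` for the un-normalised Pfaffian
`Pf(Ω) = (2ᵖp!)⁻¹ ∑_σ sgn σ Ω_{σ₁σ₂}∧⋯∧Ω_{σ_{d-1}σ_d}` of the curvature forms `Ωᵢⱼ = ½Rᵢⱼₖₗθᵏ∧θˡ` of a
positively oriented `g`-orthonormal coframe. Constant curvature `K`: `E = Kᵖ(d-1)!!√det g`.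
Normalisation: `E dx = (2π)ᵖ·Ω` for the Gauss–Bonnet integrand `Ω` of Chern 1945, (10)
(`∫_M Ω = χ(M)`). Meaningful for even `d` and `det g(x) > 0` only (junk otherwise, see the module
docstring). [cite: Chern1945, (10)] -/
def eulerDensity (g : (Fin d → ℝ) → Matrix (Fin d) (Fin d) ℝ) (x : Fin d → ℝ) : ℝ :=
  ((4 : ℝ) ^ (d / 2) * ((d / 2)! : ℝ) * Real.sqrt (g x).det)⁻¹ * eulerDensitySum g x

/-- Unfolding of `eulerDensity`. [cite: Chern1945, (10)] -/
theorem eulerDensity_def (g : (Fin d → ℝ) → Matrix (Fin d) (Fin d) ℝ) (x : Fin d → ℝ) :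
    eulerDensity g x =
      ((4 : ℝ) ^ (d / 2) * ((d / 2)! : ℝ) * Real.sqrt (g x).det)⁻¹ *
        ∑ σ : Equiv.Perm (Fin d), ∑ τ : Equiv.Perm (Fin d),
          ((Equiv.Perm.sign σ : ℤ) : ℝ) * ((Equiv.Perm.sign τ : ℤ) : ℝ) *
            ∏ m : Fin (d / 2),
              coordRiemann g x (σ (pairFst m)) (σ (pairSnd m)) (τ (pairFst m)) (τ (pairSnd m)) :=
  rfl

/-! ### Chern's transgression form pulled back by a unit field -/

/-- The odd slot `2m+1` of the `m`-th curvature pair `(2m+1, 2m+2)` of the `k`-th transgression term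
(`m < k < d/2`; slot `0` is reserved for `u`). [folklore] -/
def tgPairFst (k : Fin (d / 2)) (m : Fin k) : Fin d :=
  ⟨2 * (m : ℕ) + 1, by have := m.2; have := k.2; omega⟩

/-- The even slot `2m+2` of the `m`-th curvature pair `(2m+1, 2m+2)` of the `k`-th transgression
term (`m < k < d/2`). [folklore] -/
def tgPairSnd (k : Fin (d / 2)) (m : Fin k) : Fin d :=
  ⟨2 * (m : ℕ) + 2, by have := m.2; have := k.2; omega⟩

/-- The slot `0 : Fin d` (available since `k < d/2` forces `0 < d`). [folklore] -/
def tgZero (k : Fin (d / 2)) : Fin d := ⟨0, by have := k.2; omega⟩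

/-- `tgPairFst k m = 2m + 1` as a natural number. [folklore] -/
@[simp] theorem tgPairFst_val (k : Fin (d / 2)) (m : Fin k) : (tgPairFst k m : ℕ) = 2 * m + 1 := rfl

/-- `tgPairSnd k m = 2m + 2` as a natural number. [folklore] -/
@[simp] theorem tgPairSnd_val (k : Fin (d / 2)) (m : Fin k) : (tgPairSnd k m : ℕ) = 2 * m + 2 := rfl

/-- `tgZero k = 0` as a natural number. [folklore] -/
@[simp] theorem tgZero_val (k : Fin (d / 2)) : (tgZero k : ℕ) = 0 := rfl

/-- The `k`-th **transgression sum** in direction `i` (`k < p = d/2`):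
`Tₖ(i)(x) = ∑_{σ,τ ∈ S_d, τ(0) = i} sgn σ sgn τ · u_{σ(0)} · ∏_{m<k} R_{σ(2m+1)σ(2m+2)τ(2m+1)τ(2m+2)} ·
∏_{2k+1 ≤ s < d} (∇_{τ(s)}u)_{σ(s)}`, with `u = unitField g V`, `uᵢ = (g u)ᵢ` lowered and
`(∇ₖu)ᵢ = covDerivUnitField g V x i k`: the coordinate `ε`-`ε` contraction whose value is
`-2ᵏ√det g` times the `i`-th component of `V̂*Φₖ` (Chern's `Φₖ`, 1945, (4), in the conventions of
this file). [cite: Chern1945, (4)] -/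
def chernTransgressionSum (g : (Fin d → ℝ) → Matrix (Fin d) (Fin d) ℝ)
    (V : (Fin d → ℝ) → (Fin d → ℝ)) (x : Fin d → ℝ) (k : Fin (d / 2)) (i : Fin d) : ℝ :=
  ∑ σ : Equiv.Perm (Fin d), ∑ τ : Equiv.Perm (Fin d),
    if τ (tgZero k) = i then
      ((Equiv.Perm.sign σ : ℤ) : ℝ) * ((Equiv.Perm.sign τ : ℤ) : ℝ) *
        (g x *ᵥ unitField g V x) (σ (tgZero k)) *
        (∏ m : Fin k, coordRiemann g x (σ (tgPairFst k m)) (σ (tgPairSnd k m))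
          (τ (tgPairFst k m)) (τ (tgPairSnd k m))) *
        ∏ s ∈ univ.filter (fun s : Fin d => 2 * (k : ℕ) + 1 ≤ (s : ℕ)),
          covDerivUnitField g V x (σ s) (τ s)
    else 0

/-- The rational coefficient `cₖ = ((d-2k-1)!! · 4ᵏ · k!)⁻¹` of the `k`-th transgression sum
(`= (2ᵏ)⁻¹ ×` the coefficient `((d-2k-1)!! 2ᵏ k!)⁻¹` of `Φₖ` in `Π`; for `k < d/2` the natural-number
subtraction `d - 2k - 1` never truncates). Chern 1945, (9): `1/(1·3⋯(2p-2λ-1)·2^{p+λ}·λ!)` up to the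
overall factor `-(2π)ᵖ` of the dictionary. [cite: Chern1945, (9)] -/
def chernTransgressionCoeff (d : ℕ) (k : ℕ) : ℝ :=
  (((d - 2 * k - 1)‼ : ℕ) * (4 : ℝ) ^ k * (k ! : ℕ))⁻¹

/-- **Chern's transgression form in coordinates.** For a coordinate metric `g` and a vector field `V`
(used where `V ≠ 0`), `chernTransgression g V i x = Πᵢ(x)` is the `i`-th component of the
`(d-1)`-form `V̂*Π = ∑ᵢ Πᵢ ι_{∂ᵢ}(dx¹∧⋯∧dxᵈ)`, `Π` = Chern's form on the unit sphere bundle normalised by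
`dΠ = Pf(Ω)` (`= -(2π)ᵖ Π^{Chern}`), pulled back by the unit field `V̂ = V/|V|_g`:
`Πᵢ = -(√det g)⁻¹ ∑_{k < d/2} ((d-2k-1)!! 4ᵏ k!)⁻¹ Tₖ(i)` with `Tₖ(i) = chernTransgressionSum g V x k i`.
Its divergence is the Euler density (named fact `div_chernTransgression_eq_eulerDensity`) and for the
flat metric and `V(x) = x` it is `-2ᵖ⁻¹(p-1)! xᵢ/|x|ᵈ` (theorem `chernTransgression_flat_radial`). Meaningful for even `d`,
`det g > 0`, `V ≠ 0` only. [cite: Chern1945, (9) and (11)] -/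
def chernTransgression (g : (Fin d → ℝ) → Matrix (Fin d) (Fin d) ℝ) (V : (Fin d → ℝ) → (Fin d → ℝ))
    (i : Fin d) (x : Fin d → ℝ) : ℝ :=
  -((Real.sqrt (g x).det)⁻¹ *
      ∑ k : Fin (d / 2), chernTransgressionCoeff d k * chernTransgressionSum g V x k i)

/-- Unfolding of `chernTransgression`. [cite: Chern1945, (9)] -/
theorem chernTransgression_def (g : (Fin d → ℝ) → Matrix (Fin d) (Fin d) ℝ)
    (V : (Fin d → ℝ) → (Fin d → ℝ)) (i : Fin d) (x : Fin d → ℝ) :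
    chernTransgression g V i x =
      -((Real.sqrt (g x).det)⁻¹ *
        ∑ k : Fin (d / 2), chernTransgressionCoeff d k * chernTransgressionSum g V x k i) :=
  rfl

/-- In dimension `d = 2` only `k = 0` occurs and its coefficient is `1`: `Π = Φ₀ = ω₁₂`,
`V̂*Π = -(√det g)⁻¹ T₀`. [cite: Chern1945, (9)] -/
@[simp]
theorem chernTransgressionCoeff_two_zero : chernTransgressionCoeff 2 0 = 1 := by
  simp [chernTransgressionCoeff]

/-- The leading coefficient `c₀ = ((d-1)!!)⁻¹`. [cite: Chern1945, (9)] -/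
theorem chernTransgressionCoeff_zero (d : ℕ) : chernTransgressionCoeff d 0 = (((d - 1)‼ : ℕ) : ℝ)⁻¹ := by
  simp [chernTransgressionCoeff]

/-! ### Named facts (Chern 1944/1945; Bochnak–Coste–Roy) -/

/-- **Chern's transgression identity in coordinates** (named fact, not proved here). Let `d` be even,
`U ⊆ ℝᵈ` open, `g` a coordinate metric which is symmetric positive definite and of class `C³` on `U`,
`W ⊆ U` open and `V` a vector field of class `C²` on `W` with `V ≠ 0` on `W`. Then on `W` the
coordinate divergence of the pulled-back transgression form is the Euler density:
`∑ᵢ ∂ᵢ Πᵢ(x) = E(x)`, i.e. `d(V̂*Π) = Pf(Ω)`. This is Chern 1944, (23) `Ω = dΠ` / Chern 1945, (11)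
`-dΠ = Ω` on the unit sphere bundle, pulled back by the section `V̂` and multiplied by `(2π)ᵖ`
(dictionary in the module docstring); the smoothness makes `Πᵢ ∈ C¹(W)` so the identity is pointwise.
[cite: Chern1945, (11)] -/
def div_chernTransgression_eq_eulerDensity : Prop :=
  ∀ (d : ℕ), Even d →
    ∀ (U W : Set (Fin d → ℝ)) (g : (Fin d → ℝ) → Matrix (Fin d) (Fin d) ℝ)
      (V : (Fin d → ℝ) → (Fin d → ℝ)),
      IsOpen U → IsOpen W → W ⊆ U →
      (∀ x ∈ U, (g x).PosDef) →
      (∀ i j, ContDiffOn ℝ 3 (fun x => g x i j) U) →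
      ContDiffOn ℝ 2 V W → (∀ x ∈ W, V x ≠ 0) →
      ∀ x ∈ W, ∑ i, coordPartial i (chernTransgression g V i) x = eulerDensity g x

/-- **Semialgebraicity of the Euler density and of the transgression components** (named fact, not
proved here). If on an open set `W ⊆ ℝᵈ` the entries of `g` are `ℚ`-semialgebraic functions of class
`C²` with `g` positive definite, and the components of `V` are `ℚ`-semialgebraic of class `C¹` with
`V ≠ 0`, then `E = eulerDensity g` and every `Πᵢ = chernTransgression g V i` are `ℚ`-semialgebraic
functions on `W`: they are obtained from `g, ∂g, ∂²g, V, ∂V` by `+, ×, (·)⁻¹` (off zeros) and `√·` (of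
positive functions), and partial derivatives of semialgebraic `C¹` functions on open semialgebraic sets
are semialgebraic. Bochnak–Coste–Roy 1998, Prop. 2.2.6 (arithmetic of semialgebraic maps) and §2.9
(derivatives of semialgebraic/Nash functions). [cite: BochnakCosteRoy1998, §2.2 (Prop. 2.2.6) and §2.9] -/
def isSemialgebraicFunOn_eulerDensity_chernTransgression : Prop :=
  ∀ (d : ℕ) (W : Set (Fin d → ℝ)) (g : (Fin d → ℝ) → Matrix (Fin d) (Fin d) ℝ)
    (V : (Fin d → ℝ) → (Fin d → ℝ)),
    IsOpen W → Literature.ModelTheory.ExponentialFields.IsSemialgebraic ℚ W →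
    (∀ x ∈ W, (g x).PosDef) →
    (∀ i j, Literature.NumberTheory.Transcendental.IsSemialgebraicFunOn ℚ W fun x => g x i j) →
    (∀ i j, ContDiffOn ℝ 2 (fun x => g x i j) W) →
    (∀ j, Literature.NumberTheory.Transcendental.IsSemialgebraicFunOn ℚ W fun x => V x j) →
    ContDiffOn ℝ 1 V W → (∀ x ∈ W, V x ≠ 0) →
    Literature.NumberTheory.Transcendental.IsSemialgebraicFunOn ℚ W (eulerDensity g) ∧
      ∀ i, Literature.NumberTheory.Transcendental.IsSemialgebraicFunOn ℚ W (chernTransgression g V i)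

/-! ### Elementary consequences of the definitions (proved) -/

/-- The Euler density vanishes at every point where the covariant Riemann tensor vanishes
identically (`d ≥ 2`, so that each product has at least one curvature factor); e.g. for a flat
metric. [cite: Chern1945, (10)] -/
theorem eulerDensity_eq_zero_of_coordRiemann_eq_zero (g : (Fin d → ℝ) → Matrix (Fin d) (Fin d) ℝ)
    (x : Fin d → ℝ) (hd : 2 ≤ d) (hR : ∀ i j k l, coordRiemann g x i j k l = 0) :
    eulerDensity g x = 0 := by
  have hp : 0 < d / 2 := by omega
  have hsum : eulerDensitySum g x = 0 := by
    refine Finset.sum_eq_zero fun σ _ => Finset.sum_eq_zero fun τ _ => ?_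
    rw [Finset.prod_eq_zero (Finset.mem_univ (⟨0, hp⟩ : Fin (d / 2))) (hR _ _ _ _), mul_zero]
  rw [eulerDensity, hsum, mul_zero]

/-- The transgression sums with at least one curvature factor (`0 < k`) vanish wherever the covariant
Riemann tensor vanishes (flat points): only the `Φ₀`-term survives, as on a fibre of the sphere bundle.
[cite: Chern1944, (25)–(26)] -/
theorem chernTransgressionSum_eq_zero_of_coordRiemann_eq_zero
    (g : (Fin d → ℝ) → Matrix (Fin d) (Fin d) ℝ) (V : (Fin d → ℝ) → (Fin d → ℝ)) (x : Fin d → ℝ)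
    (k : Fin (d / 2)) (hk : 0 < (k : ℕ)) (i : Fin d) (hR : ∀ i j k l, coordRiemann g x i j k l = 0) :
    chernTransgressionSum g V x k i = 0 := by
  refine Finset.sum_eq_zero fun σ _ => Finset.sum_eq_zero fun τ _ => ?_
  split_ifs
  · rw [Finset.prod_eq_zero (Finset.mem_univ (⟨0, hk⟩ : Fin k)) (hR _ _ _ _)]
    ring
  · rfl


/-! ### The flat radial case: `chernTransgression_flat_radial`

For the constant metric `g = 1` the Christoffel symbols and the curvature vanish, so only the
`k = 0` transgression sum survives; with `V(x) = x` one has `u = x/|x|`, `(∇_b u)_a = δ_ab/|x| -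
x_a x_b/|x|³`, the inner alternating sum over `σ` is a determinant (`Matrix.det_apply'`), the
restricted sum over `τ` contributes `(d-1)!` equal terms (`Equiv.Perm.decomposeFin`), and the
remaining determinant is `xᵢ/|x|ᵈ` by two applications of the matrix determinant lemma. -/

section FlatRadial

open scoped Topology

/-- The Christoffel symbols of the constant metric `g = 1` vanish. [folklore] -/
theorem coordChristoffel_flat (y : Fin d → ℝ) (i j k : Fin d) :
    coordChristoffel (fun _ => (1 : Matrix (Fin d) (Fin d) ℝ)) y i j k = 0 := by
  simp [coordChristoffel]

/-- The curvature endomorphism of the constant metric `g = 1` vanishes. [folklore] -/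
theorem coordRiemannUp_flat (y : Fin d → ℝ) (i j k l : Fin d) :
    coordRiemannUp (fun _ => (1 : Matrix (Fin d) (Fin d) ℝ)) y i j k l = 0 := by
  simp [coordRiemannUp, coordChristoffel_flat]

/-- The Riemann tensor of the constant metric `g = 1` vanishes. [folklore] -/
theorem coordRiemann_flat (y : Fin d → ℝ) (i j k l : Fin d) :
    coordRiemann (fun _ => (1 : Matrix (Fin d) (Fin d) ℝ)) y i j k l = 0 := by
  simp [coordRiemann, coordRiemannUp_flat]

/-- For `g = 1` and `V(y) = y` the unit field is `u(y) = y/√(y·y)`. [folklore] -/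
theorem unitField_flat_apply (y : Fin d → ℝ) (a : Fin d) :
    unitField (fun _ => (1 : Matrix (Fin d) (Fin d) ℝ)) (fun z => z) y a = (Real.sqrt (y ⬝ᵥ y))⁻¹ * y a := by
  simp [unitField, metricNormSq, Matrix.one_mulVec]

/-- `y · y ≥ 0`. [folklore] -/
theorem dotProduct_self_nonneg' (y : Fin d → ℝ) : 0 ≤ y ⬝ᵥ y :=
  Finset.sum_nonneg fun j _ => mul_self_nonneg (y j)

/-- `x · x > 0` for `x ≠ 0`. [folklore] -/
theorem dotProduct_self_pos' {x : Fin d → ℝ} (hx : x ≠ 0) : 0 < x ⬝ᵥ x :=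
  lt_of_le_of_ne (dotProduct_self_nonneg' x) (Ne.symm (dotProduct_self_eq_zero.not.mpr hx))

/-- The partial derivatives of the flat unit radial field: `∂_b (x_a/|x|) = δ_ab/|x| - x_a x_b/|x|³`.
[folklore] -/
theorem coordPartial_unitField_flat {x : Fin d → ℝ} (hx : x ≠ 0) (a b : Fin d) :
    coordPartial b (fun y => unitField (fun _ => (1 : Matrix (Fin d) (Fin d) ℝ)) (fun z => z) y a) x =
      (if a = b then 1 else 0) / Real.sqrt (x ⬝ᵥ x) - x a * x b / Real.sqrt (x ⬝ᵥ x) ^ 3 := by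
  have hS : 0 < x ⬝ᵥ x := dotProduct_self_pos' hx
  have hN : Real.sqrt (x ⬝ᵥ x) ≠ 0 := (Real.sqrt_pos.mpr hS).ne'
  -- derivative of `y ↦ y · y`, then of `√`, `⁻¹` and the product with `y a`
  have hdot : HasFDerivAt (fun y : Fin d → ℝ => y ⬝ᵥ y)
      (∑ j : Fin d, (x j • (ContinuousLinearMap.proj j : (Fin d → ℝ) →L[ℝ] ℝ) +
        x j • (ContinuousLinearMap.proj j : (Fin d → ℝ) →L[ℝ] ℝ))) x := by
    have : (fun y : Fin d → ℝ => y ⬝ᵥ y) = fun y => ∑ j, y j * y j := rfl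
    rw [this]
    exact HasFDerivAt.fun_sum fun j _ =>
      (hasFDerivAt_apply (𝕜 := ℝ) j x).fun_mul (hasFDerivAt_apply (𝕜 := ℝ) j x)
  have hsqrt := hdot.sqrt hS.ne'
  have hinv := (hasDerivAt_inv hN).comp_hasFDerivAt x hsqrt
  have hu := hinv.fun_mul (hasFDerivAt_apply (𝕜 := ℝ) a x)
  have hu' := hu.congr_of_eventuallyEq (f₁ := fun y =>
      unitField (fun _ => (1 : Matrix (Fin d) (Fin d) ℝ)) (fun z => z) y a)
    (Filter.Eventually.of_forall fun y => unitField_flat_apply y a)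
  rw [coordPartial, hu'.fderiv]
  simp only [Function.comp_apply, _root_.add_apply, FunLike.coe_smul,
    Pi.smul_apply, ContinuousLinearMap.proj_apply, FunLike.coe_sum, Finset.sum_apply,
    Pi.single_apply, smul_eq_mul, mul_ite, mul_one, mul_zero, Finset.sum_add_distrib,
    Finset.sum_ite_eq', Finset.mem_univ, if_true]
  by_cases hab : a = b
  · simp only [hab, if_true]
    field_simp
    ring
  · simp only [hab, if_false]
    field_simp
    ring

/-- The covariant derivative of the flat unit radial field (`Γ = 0`):
`(∇_b u)_a = δ_ab/|x| - x_a x_b/|x|³`. [folklore] -/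
theorem covDerivUnitField_flat {x : Fin d → ℝ} (hx : x ≠ 0) (a b : Fin d) :
    covDerivUnitField (fun _ => (1 : Matrix (Fin d) (Fin d) ℝ)) (fun z => z) x a b =
      (if a = b then 1 else 0) / Real.sqrt (x ⬝ᵥ x) - x a * x b / Real.sqrt (x ⬝ᵥ x) ^ 3 := by
  simp only [covDerivUnitField, coordChristoffel_flat, zero_mul, Finset.sum_const_zero, add_zero,
    Matrix.one_apply, ite_mul, one_mul, zero_mul, Finset.sum_ite_eq, Finset.mem_univ, if_true]
  exact coordPartial_unitField_flat hx a b

/-- The lowered flat unit radial field: `u_a = x_a/|x|`. [folklore] -/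
theorem mulVec_unitField_flat (x : Fin d → ℝ) (a : Fin d) :
    ((fun _ => (1 : Matrix (Fin d) (Fin d) ℝ)) x *ᵥ
        unitField (fun _ => (1 : Matrix (Fin d) (Fin d) ℝ)) (fun z => z) x) a =
      (Real.sqrt (x ⬝ᵥ x))⁻¹ * x a := by
  simp only [Matrix.one_mulVec]
  exact unitField_flat_apply x a

/-- The inner alternating sum of the `k = 0` transgression term is a determinant with permuted
columns: for `τ` with `τ z = i`,
`∑_σ sgn σ · u(σ z) · ∏_{s ≠ z} M(σ s, τ s) = sgn τ · det B`, `B(a, c) = u(a)` if `c = i` and `M(a, c)`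
otherwise. [folklore] -/
theorem sum_sign_mul_prod_erase_eq_det {n : ℕ} (z i : Fin n) (τ : Equiv.Perm (Fin n)) (hτ : τ z = i)
    (uL : Fin n → ℝ) (M : Fin n → Fin n → ℝ) :
    ∑ σ : Equiv.Perm (Fin n),
        ((Equiv.Perm.sign σ : ℤ) : ℝ) * (uL (σ z) * ∏ s ∈ univ.erase z, M (σ s) (τ s)) =
      ((Equiv.Perm.sign τ : ℤ) : ℝ) * (Matrix.of fun a c => if c = i then uL a else M a c).det := by
  set B : Matrix (Fin n) (Fin n) ℝ := Matrix.of fun a c => if c = i then uL a else M a c with hB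
  have hA : ∀ σ : Equiv.Perm (Fin n),
      uL (σ z) * ∏ s ∈ univ.erase z, M (σ s) (τ s) = ∏ s, (B.submatrix id τ) (σ s) s := by
    intro σ
    rw [← Finset.mul_prod_erase univ _ (Finset.mem_univ z)]
    congr 1
    · simp [B, hτ]
    · refine Finset.prod_congr rfl fun s hs => ?_
      have hs' : s ≠ z := Finset.ne_of_mem_erase hs
      have hne : τ s ≠ i := fun h => hs' (τ.injective (h.trans hτ.symm))
      simp [B, hne]
  simp_rw [hA, ← Matrix.det_apply', Matrix.det_permute']

/-- Counting: `∑_{τ ∈ S_{n+1}, τ 0 = i} c = n! · c`. [folklore] -/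
theorem sum_perm_ite_apply_zero_eq {n : ℕ} (i : Fin (n + 1)) (c : ℝ) :
    ∑ τ : Equiv.Perm (Fin (n + 1)), (if τ 0 = i then c else 0) = (n ! : ℕ) * c := by
  rw [← Equiv.sum_comp Equiv.Perm.decomposeFin.symm, Fintype.sum_prod_type]
  simp only [Equiv.Perm.decomposeFin_symm_apply_zero, Finset.sum_const, Finset.card_univ,
    Fintype.card_perm, Fintype.card_fin, nsmul_eq_mul]
  rw [← Finset.mul_sum, Finset.sum_ite_eq', if_pos (Finset.mem_univ _)]

/-- The determinant behind the fibre integral: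
`det [c = i ↦ x_a/N ; c ≠ i ↦ δ_ac/N - x_a x_c/N³] = x_i / Nⁿ`, by writing the matrix as
`N⁻¹ • (1 + (x - eᵢ)eᵢᵀ)(1 - eᵢwᵀ)` and two matrix determinant lemmas. [folklore] -/
theorem det_flatRadialMatrix {n : ℕ} (x : Fin n → ℝ) (i : Fin n) {N : ℝ} (hN : N ≠ 0) :
    (Matrix.of fun a c : Fin n =>
        if c = i then N⁻¹ * x a else (if a = c then (1 : ℝ) else 0) / N - x a * x c / N ^ 3).det =
      N⁻¹ ^ n * x i := by
  set e : Fin n → ℝ := Pi.single i 1 with he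
  set w : Fin n → ℝ := fun c => if c = i then 0 else x c / N ^ 2 with hw
  have hei : e i = 1 := by simp [e]
  have hwi : w i = 0 := by simp [w]
  have hprod : (1 + vecMulVec (x - e) e) * (1 - vecMulVec e w) =
      1 - vecMulVec e w + vecMulVec (x - e) e - vecMulVec (x - e) w := by
    rw [Matrix.add_mul, Matrix.one_mul, Matrix.mul_sub, Matrix.mul_one, vecMulVec_mul_vecMulVec]
    have : e ⬝ᵥ e = 1 := by simp [e]
    rw [this, one_smul]
    abel
  have hB : (Matrix.of fun a c : Fin n =>
        if c = i then N⁻¹ * x a else (if a = c then (1 : ℝ) else 0) / N - x a * x c / N ^ 3) =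
      N⁻¹ • ((1 + vecMulVec (x - e) e) * (1 - vecMulVec e w)) := by
    rw [hprod]
    ext a c
    by_cases hc : c = i
    · subst hc
      simp only [Matrix.of_apply, if_true, Matrix.smul_apply, Matrix.sub_apply, Matrix.add_apply,
        Matrix.one_apply, vecMulVec_apply, Pi.sub_apply, hei, hwi, smul_eq_mul]
      by_cases ha : a = c
      · subst ha; rw [hei, if_pos rfl]; ring
      · have : e a = 0 := by simp [e, ha]
        rw [this, if_neg ha]; ring
    · have hec : e c = 0 := by simp [e, hc]
      have hwc : w c = x c / N ^ 2 := by simp [w, hc]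
      simp only [Matrix.of_apply, if_neg hc, Matrix.smul_apply, Matrix.sub_apply, Matrix.add_apply,
        Matrix.one_apply, vecMulVec_apply, Pi.sub_apply, hec, hwc, smul_eq_mul]
      field_simp
      ring
  have h1 : (1 + vecMulVec (x - e) e).det = x i := by
    rw [vecMulVec_eq (Fin 1), Matrix.det_one_add_replicateCol_mul_replicateRow]
    simp [e]
  have h2 : (1 - vecMulVec e w).det = 1 := by
    rw [sub_eq_add_neg, ← vecMulVec_neg, vecMulVec_eq (Fin 1),
      Matrix.det_one_add_replicateCol_mul_replicateRow]
    simp [e, w]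
  rw [hB, Matrix.det_smul, Matrix.det_mul, h1, h2, mul_one, Fintype.card_fin]

/-- **The transgression form of the flat metric along the radial field** (proved). For
`d = 2p ≥ 2`, the constant metric `g = 1` and `V(x) = x` on `ℝᵈ ∖ {0}`:
`Πᵢ(x) = -2ᵖ⁻¹ (p-1)! · xᵢ / |x|ᵈ` (`|x|ᵈ = (∑ⱼxⱼ²)ᵖ`). Equivalently `V̂*Π = -(d-2)!!·V̂*(dσ_{d-1})`,
`dσ_{d-1}` the volume form of the unit sphere: this is the coordinate form of "the restriction of `Π`
to a fibre of the sphere bundle is `((d-1)!!)⁻¹Φ₀ = (d-2)!!·dσ_{d-1}`" (Chern 1944, (26); Chern 1945,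
(14)–(16), Kronecker's integral), in the present normalisation `Π = -(2π)ᵖΠ^{Chern}`. Consequently the
flux `∑ᵢ ∮ Πᵢ νᵢ` through any sphere `|x| = r` with its outward normal is
`-2ᵖ⁻¹(p-1)!·vol(S^{d-1}) = -(2π)ᵖ = -(d-1)!!·vol(Sᵈ)/2` (`-2π, -4π², -8π³` for `d = 2, 4, 6`), and
`+(2π)ᵖ` per unit of index with the boundary orientation of the complement of a ball, which is how
`∫_M Pf(Ω) = (2π)ᵖ χ(M)` arises (Chern 1945, (16)–(17)). Proof: flat-case lemmas above, the inner
alternating sum is a permuted determinant, `(d-1)!` equal terms, and `det_flatRadialMatrix`.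
[cite: Chern1944, (26)] -/
theorem chernTransgression_flat_radial (d : ℕ) (hd : Even d) (hd0 : 0 < d) (x : Fin d → ℝ)
    (hx : x ≠ 0) (i : Fin d) :
    chernTransgression (fun _ => (1 : Matrix (Fin d) (Fin d) ℝ)) (fun y => y) i x =
      -((2 : ℝ) ^ (d / 2 - 1) * (((d / 2 - 1)! : ℕ) : ℝ)) * x i / (∑ j, x j ^ 2) ^ (d / 2) := by
  obtain ⟨q, rfl⟩ : ∃ q, d = 2 * q + 2 := by
    obtain ⟨r, hr⟩ := hd
    exact ⟨r - 1, by omega⟩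
  -- numerology of the dimension
  have hhalf : (2 * q + 2) / 2 = q + 1 := by omega
  have hS : 0 < x ⬝ᵥ x := dotProduct_self_pos' hx
  set N : ℝ := Real.sqrt (x ⬝ᵥ x) with hNdef
  have hNpos : 0 < N := Real.sqrt_pos.mpr hS
  have hN : N ≠ 0 := hNpos.ne'
  have hN2 : N ^ 2 = x ⬝ᵥ x := Real.sq_sqrt hS.le
  -- the index `k = 0`
  have hp : 0 < (2 * q + 2) / 2 := by omega
  set k0 : Fin ((2 * q + 2) / 2) := ⟨0, hp⟩ with hk0
  -- Step 1: only `k = 0` survives, `det 1 = 1`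
  have hflatR := coordRiemann_flat (d := 2 * q + 2) x
  rw [chernTransgression_def, Matrix.det_one, Real.sqrt_one, inv_one, one_mul,
    Finset.sum_eq_single k0 ?_ (by simp)]
  rotate_left
  · intro k _ hk
    have hkpos : 0 < (k : ℕ) := by
      rcases Nat.eq_zero_or_pos (k : ℕ) with h | h
      · exact absurd (Fin.ext h) hk
      · exact h
    rw [chernTransgressionSum_eq_zero_of_coordRiemann_eq_zero _ _ x k hkpos i hflatR, mul_zero]
  -- Step 2: evaluate the `k = 0` transgression sum
  have hz : (tgZero k0 : Fin (2 * q + 2)) = 0 := Fin.ext rfl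
  have hfilter : univ.filter (fun s : Fin (2 * q + 2) => 2 * (k0 : ℕ) + 1 ≤ (s : ℕ)) = univ.erase 0 := by
    ext s
    simp only [Finset.mem_filter, Finset.mem_univ, true_and, Finset.mem_erase, and_true, hk0]
    rw [Ne, Fin.ext_iff]
    simp only [Fin.val_zero]
    omega
  set M : Fin (2 * q + 2) → Fin (2 * q + 2) → ℝ :=
    fun a c => (if a = c then (1 : ℝ) else 0) / N - x a * x c / N ^ 3 with hM
  set uL : Fin (2 * q + 2) → ℝ := fun a => N⁻¹ * x a with huL
  have hsum : chernTransgressionSum (fun _ => (1 : Matrix (Fin (2 * q + 2)) (Fin (2 * q + 2)) ℝ))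
      (fun y => y) x k0 i =
      ((2 * q + 1)! : ℕ) * (Matrix.of fun a c => if c = i then uL a else M a c).det := by
    unfold chernTransgressionSum
    have hterm : ∀ σ τ : Equiv.Perm (Fin (2 * q + 2)),
        (if τ (tgZero k0) = i then
          ((Equiv.Perm.sign σ : ℤ) : ℝ) * ((Equiv.Perm.sign τ : ℤ) : ℝ) *
            ((fun _ => (1 : Matrix (Fin (2 * q + 2)) (Fin (2 * q + 2)) ℝ)) x *ᵥ
              unitField (fun _ => (1 : Matrix (Fin (2 * q + 2)) (Fin (2 * q + 2)) ℝ)) (fun y => y) x)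
              (σ (tgZero k0)) *
            (∏ m : Fin (k0 : ℕ), coordRiemann (fun _ => (1 : Matrix (Fin (2 * q + 2)) (Fin (2 * q + 2)) ℝ)) x
              (σ (tgPairFst k0 m)) (σ (tgPairSnd k0 m)) (τ (tgPairFst k0 m)) (τ (tgPairSnd k0 m))) *
            ∏ s ∈ univ.filter (fun s : Fin (2 * q + 2) => 2 * (k0 : ℕ) + 1 ≤ (s : ℕ)),
              covDerivUnitField (fun _ => (1 : Matrix (Fin (2 * q + 2)) (Fin (2 * q + 2)) ℝ)) (fun y => y) x
                (σ s) (τ s)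
          else 0) =
        if τ 0 = i then
          ((Equiv.Perm.sign τ : ℤ) : ℝ) *
            (((Equiv.Perm.sign σ : ℤ) : ℝ) * (uL (σ 0) * ∏ s ∈ univ.erase 0, M (σ s) (τ s)))
          else 0 := by
      intro σ τ
      rw [hz, hfilter]
      split_ifs with h
      · have hempty : (Finset.univ : Finset (Fin (k0 : ℕ))) = ∅ := by
          rw [hk0]; exact Finset.univ_eq_empty
        rw [hempty, Finset.prod_empty, mul_one, mulVec_unitField_flat]
        simp_rw [covDerivUnitField_flat hx]
        ring
      · rfl
    simp_rw [hterm]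
    rw [Finset.sum_comm]
    have hinner : ∀ τ : Equiv.Perm (Fin (2 * q + 2)),
        (∑ σ : Equiv.Perm (Fin (2 * q + 2)),
          if τ 0 = i then
            ((Equiv.Perm.sign τ : ℤ) : ℝ) *
              (((Equiv.Perm.sign σ : ℤ) : ℝ) * (uL (σ 0) * ∏ s ∈ univ.erase 0, M (σ s) (τ s)))
          else 0) =
        if τ 0 = i then (Matrix.of fun a c => if c = i then uL a else M a c).det else 0 := by
      intro τ
      split_ifs with hτ
      · rw [← Finset.mul_sum, sum_sign_mul_prod_erase_eq_det 0 i τ hτ uL M, ← mul_assoc,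
          ← Int.cast_mul, ← Units.val_mul, Int.units_mul_self, Units.val_one, Int.cast_one, one_mul]
      · simp
    simp_rw [hinner]
    exact sum_perm_ite_apply_zero_eq i _
  -- Step 3: the determinant
  have hdet : (Matrix.of fun a c => if c = i then uL a else M a c).det = N⁻¹ ^ (2 * q + 2) * x i :=
    det_flatRadialMatrix x i hN
  rw [hsum, hdet, chernTransgressionCoeff_zero, hhalf, Nat.add_sub_cancel]
  -- Step 4: constants: (2q+1)!/(2q+1)‼ = (2q)‼ = 2^q q!, and N^(2q+2) = (x·x)^(q+1)
  have hfac : ((2 * q + 1)! : ℝ) = ((2 * q + 1)‼ : ℕ) * (2 ^ q * q ! : ℕ) := by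
    rw [← Nat.doubleFactorial_two_mul, ← Nat.cast_mul, ← Nat.factorial_eq_mul_doubleFactorial]
  have hdf : (((2 * q + 2 - 1)‼ : ℕ) : ℝ) = ((2 * q + 1)‼ : ℕ) := by
    rw [show 2 * q + 2 - 1 = 2 * q + 1 by omega]
  have hdfpos : (((2 * q + 1)‼ : ℕ) : ℝ) ≠ 0 := by positivity
  have hsq : ∑ j, x j ^ 2 = x ⬝ᵥ x := by simp [dotProduct, sq]
  have hNpow : N ^ (2 * q + 2) = (x ⬝ᵥ x) ^ (q + 1) := by
    rw [← hN2, ← pow_mul]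
    ring
  rw [hdf, hfac, hsq, ← hNpow, inv_pow]
  push_cast
  field_simp

end FlatRadial
end Literature.Geometry.Riemannian
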